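import Summits.BirchSwinnertonDyer.Rank1Residual.X11b.BDPRouteRecordPinned
import Summits.BirchSwinnertonDyer.Rank1Residual.X11b.AnticyclotomicEulerCharLinks
import HarnessLib

/-!
# Class X11b, route "BDP + converse-theorem engine + Kolyvagin" (p2): route p2 needs only ONE HALF of the control theorem — `ord_p f_ac(0) ≤ …`, i.e. an UPPER BOUND on `#H⁰(Γ, Sel_𝔭(K_∞, E[p^∞]))` (cell `b2b-bsdres`, sub-cell `multr1-p2`, gen 12)

HONEST FRAMING (verbatim, cell `b2b-bsdres`): the goal of the cell is to DELETE the
COMBINATION-SHAPED residual classes for ALL analytic-rank `≤ 1` curves over `ℚ` — "full BSD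
formula for every rank `≤ 1` curve in class `C`" assembled STRICTLY from published theorems — so
that the rank-`≤ 1` remainder becomes exactly the CONSTRUCTION-SHAPED classes, which are TYPED
(missing-input Props), NOT attempted; this is not "finishing BSD". Research route `p2` for class
X11b; no claim beyond the stated class; nothing booked; X11b stays CONSTRUCTION-SHAPED. ONE
`Prop`-valued PREDICATE (nothing asserted) and theorems; no named fact; no `sorry`. Continuation of
`BDPRouteRecordPinned.lean` and of the sibling sub-cell's `AnticyclotomicEulerCharLinks.lean`
(multr1-p1: `controlOnTreeAt_iff_card`).

## Content — the one-sided control input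

Route p2 proves the MAIN-CONJECTURE HALF `ord_p #Ш(E)_an ≤ ord_p #Ш(E)` through STEP L
`2·ord_p[E(K):ℤP] ≤ ord_p #Ш(E/K) + 2·ord_p ∏c_ℓ(E)`, obtained from (IMC≥∘BDP)ᵗ
`2·(ord_p log_ω P − 1) ≤ ord_p f_ac(0)` [OPEN at `p ∥ N`] and the control theorem (CTL)ᵗ = Cas18
Thm. 2.3 `ord_p f_ac(0) = ord_p #Ш(E/K)[p^∞] + 2((ord_p log_ω P − 1) − ord_p[E(K):ℤP]) + ord_p ∏_{w∣N⁺} c_w`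
[PUB]. Of the control IDENTITY only the inequality `≤` is used. This file records that:

* `ControlUpperOnTreeAt p κ 𝔭 γ ι P` — (CTL≤)ᵗ: `X_ac(E[p^∞])` is `Λ`-torsion with `f_ac(0) ≠ 0`
  and `ord_p f_ac(0) ≤ ord_p #Ш(E/K)[p^∞] + 2((ord_p log_ω P − 1) − ord_p[E(K):ℤP]) + ord_p ∏_{w∣N⁺} c_w`,
  every symbol a tree object; implied by `ControlOnTreeAt` (`controlUpperOnTreeAt_of_controlOnTreeAt`).
* `controlUpperOnTreeAt_iff_card` — Euler-characteristic form (multr1-p1's `XAc.hasCharValuationAt_iff_card`):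
  (CTL≤)ᵗ ⟺ `∃ n ≤ …, Sel_𝔭(K_∞,E[p^∞])^γ finite ∧ #Sel^γ = p^n·#Sel_γ`.
* **`controlUpperOnTreeAt_of_natCard_invariants_le`** — the algebraic input of route p2 at a datum
  is implied by ONE INEQUALITY ON ONE FINITE GROUP: if `Sel_𝔭(K_∞, E[p^∞])^γ` is finite of order
  `≤ p^m` with `m ≤ ord_p #Ш(E/K)[p^∞] + 2((ord_p log_ω P − 1) − ord_p[E(K):ℤP]) + ord_p ∏_{w∣N⁺} c_w`,
  then (CTL≤)ᵗ holds (torsion and `f(0) ≠ 0` follow by Greenberg's criterion,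
  `exists_hasCharValuationAt_of_finite_invariants`; `#Sel_γ ≥ 1`). In Greenberg's proof of control
  (LNM 1716 §3; JSW17 §3.3) this is the direction "`#Sel(K_∞)^Γ ≤ #Sel(K) · ∏_v #ker r_v`"
  (inflation–restriction with `E(K_∞)[p^∞] = 0`, snake lemma, local kernels) together with
  `#H¹_ac(K, E[p^∞]) ≤ #Ш(E/K)[p^∞]·δ_v²` (JSW17 Prop. 3.2.1, whose inequality `≤` uses only the
  reciprocity half of Poitou–Tate); the surjectivity of the localisation maps (JSW17 §3.3.1) and the
  equality half of global duality are NOT needed by route p2.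
* The datum chain re-threaded with (CTL≤)ᵗ in place of (CTL)ᵗ: `two_mul_index_le_of_onTreeUpperLinks`,
  `indexLowerBoundAt_of_onTreeUpperLinks_of_heegner`, `indexLowerBoundAt_of_heegner_of_onTreeUpperLinks`,
  `indexLowerBoundAt_of_heegner_of_onTreeUpperInputs`.
* The class level ((T1ᵗ-CTL≤) as a predicate `P2ControlUpperOnTreeAt W p` on `(E,p)` and the gen-12
  statement of record `P2.bsdp_of_onTree_final`) is `BDPRouteRecordFinal.lean`. CONDITIONAL; nothing
  booked; reach and labels unchanged.

References: [Castella2018] Thm. 2.3 (arXiv:1704.06608 p. 5), Thm. 3.2 (p. 9); [Castella2018Erratum]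
(2.4), Thm. 1.1; [JetchevSkinnerWan2017] Prop. 3.2.1, Thm. 3.3.1 (= Thm. 8 of arXiv:1512.06894
p. 11), §3.3.1–3.3.6, §7.4.1; [GreenbergLNM1716] §3 (pp. 85–90), §4 Lemma 4.2 (p. 102); the references
of `BDPRouteRecordPinned.lean`.
-/

noncomputable section

open scoped Classical

open WeierstrassCurve NumberField IsDedekindDomain Literature.NumberTheory.EllipticCurves
  Literature.NumberTheory.EllipticCurves.ModularForms
  Literature.NumberTheory.EllipticCurves.Rank1Residual
  Literature.NumberTheory.EllipticCurves.Rank1Residual.Typed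
  Literature.NumberTheory.EllipticCurves.Wuthrich2014
  Literature.NumberTheory.EllipticCurves.BalakrishnanEtAl2019
  Literature.NumberTheory.QuadraticFields.Quadratic
  Summit.BirchSwinnertonDyer.Rank1Residual.X11b.AcSelmer

namespace Summit.BirchSwinnertonDyer.Rank1Residual.X11b

/-! ### (CTL≤)ᵗ: the half of Cas18 Thm. 2.3 that route p2 consumes -/

section Links

variable {W : WeierstrassCurve ℚ} [W.IsElliptic] [W.IsGloballyMinimal] {K : Type} [Field K]
  [NumberField K]
variable (p : ℕ) [Fact p.Prime] (κ : ZpExtension K p) (𝔭 : HeightOneSpectrum (𝓞 K))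
  (γ : Field.absoluteGaloisGroup K) [Fact (κ.IsTopGenerator γ)] (ι : K →+* ℚ_[p])

/-- **(CTL≤)ᵗ — the UPPER half of Cas18 Thm. 2.3 (anticyclotomic control), `p ∣ N`, `Σ = ∅`, at
`P`, every symbol a tree object — PUB shape.** The constructed `X_ac = AcSelmer.XAc (E_K) p κ 𝔭 ∅ γ`
is `Λ`-torsion with a generator `f` of its characteristic ideal, `f(0) ≠ 0`, and
`ord_p f(0) ≤ ord_p #Ш(E/K)[p^∞] + 2·((ord_p log_ω P − 1) − ord_p[E(K):ℤP]) + ord_p ∏_{w∣N⁺} c_w(E/K)`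
(`ord_p log_ω P = padicLogOrd W p ι P`, `∏_{w∣N⁺} c_w = tamagawaProductSplit W K`). This is the only
consequence of the control identity `ControlOnTreeAt` used by route p2
(`controlUpperOnTreeAt_of_controlOnTreeAt`). A predicate; nothing asserted; NOT a named fact.
[cite: Castella2018, Thm. 2.3 (arXiv:1704.06608 p. 5) (shape only; nothing asserted)]
[cite: JetchevSkinnerWan2017, Thm. 3.3.1 (shape only; nothing asserted)] -/
def ControlUpperOnTreeAt (P : (W.baseChange K).toAffine.Point) : Prop :=
  ∃ n : ℕ, XAc.HasCharValuationAt (W.baseChange K) p κ 𝔭 ∅ γ n ∧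
    (n : ℤ) ≤ (padicValNat p (Nat.card (AddCommGroup.primaryComponent (W.baseChange K).sha p)) : ℤ) +
      2 * ((padicLogOrd W p ι P - 1) - (padicValNat p (AddSubgroup.zmultiples P).index : ℤ)) +
        padicValNat p (tamagawaProductSplit W K)

variable {p κ 𝔭 γ ι}

/-- (CTL)ᵗ (the identity, Cas18 Thm. 2.3) implies (CTL≤)ᵗ. [folklore] -/
theorem controlUpperOnTreeAt_of_controlOnTreeAt {P : (W.baseChange K).toAffine.Point}
    (h : ControlOnTreeAt p κ 𝔭 γ ι P) : ControlUpperOnTreeAt p κ 𝔭 γ ι P := by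
  obtain ⟨n, hn, hne⟩ := h
  exact ⟨n, hn, le_of_eq hne⟩

variable (p κ 𝔭 γ ι) in
/-- **(CTL≤)ᵗ in Euler-characteristic form**: at a datum it holds IF AND ONLY IF there is `n : ℕ`,
`n ≤ ord_p #Ш(E/K)[p^∞] + 2((ord_p log_ω P − 1) − ord_p[E(K):ℤP]) + ord_p ∏_{w∣N⁺} c_w`, with
`Sel_𝔭(K_∞, E[p^∞])^γ` finite and `#Sel^γ = p^n · #Sel_γ` (multr1-p1's
`XAc.hasCharValuationAt_iff_card`, Greenberg LNM 1716 Lemma 4.2).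
[cite: GreenbergLNM1716, §4 Lemma 4.2 (p. 102)] [cite: Castella2018, Thm. 2.3 (arXiv:1704.06608 p. 5) (shape only; nothing asserted)] -/
theorem controlUpperOnTreeAt_iff_card (P : (W.baseChange K).toAffine.Point) :
    ControlUpperOnTreeAt p κ 𝔭 γ ι P ↔
      ∃ n : ℕ, (∃ _ : Finite (IwasawaDual.endInvariants
            (conjSelmerAc (W.baseChange K) p κ 𝔭 ∅ γ - 1)),
          Nat.card (IwasawaDual.endInvariants (conjSelmerAc (W.baseChange K) p κ 𝔭 ∅ γ - 1)) =
            p ^ n * Nat.card (IwasawaDual.EndCoinvariants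
              (conjSelmerAc (W.baseChange K) p κ 𝔭 ∅ γ - 1))) ∧
        (n : ℤ) ≤ (padicValNat p
            (Nat.card (AddCommGroup.primaryComponent (W.baseChange K).sha p)) : ℤ) +
          2 * ((padicLogOrd W p ι P - 1) - (padicValNat p (AddSubgroup.zmultiples P).index : ℤ)) +
            padicValNat p (tamagawaProductSplit W K) := by
  haveI := module_finite_XAc_baseChange p κ 𝔭 γ (W := W)
  unfold ControlUpperOnTreeAt
  simp only [XAc.hasCharValuationAt_iff_card]

/-- **Route p2's algebraic input at a datum is ONE INEQUALITY ON ONE FINITE GROUP.** If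
`Sel_𝔭(K_∞, E[p^∞])^γ = H⁰(Γ, Sel_𝔭(K_∞, E[p^∞]))` is finite of order at most `p^m` with
`m ≤ ord_p #Ш(E/K)[p^∞] + 2((ord_p log_ω P − 1) − ord_p[E(K):ℤP]) + ord_p ∏_{w∣N⁺} c_w(E/K)`, then
(CTL≤)ᵗ holds: `X_ac` is torsion with `ord_p f_ac(0)` defined by Greenberg's criterion
(`exists_hasCharValuationAt_of_finite_invariants`), `#Sel^γ = p^{ord_p f_ac(0)}·#Sel_γ ≥ p^{ord_p f_ac(0)}`
(Lemma 4.2), so `ord_p f_ac(0) ≤ m`. In Greenberg's / JSW's proof of the control theorem this bound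
is the direction "`#Sel(K_∞)^Γ ≤ #Sel(K)·∏_v #ker r_v`" with `#H¹_ac(K,E[p^∞]) ≤ #Ш·δ_v²`; the
surjectivity of the localisation maps (JSW17 §3.3.1) is not needed for it.
[cite: GreenbergLNM1716, §3 (pp. 85–86, 90) and §4 Lemma 4.2 (p. 102)]
[cite: JetchevSkinnerWan2017, Prop. 3.2.1 and §3.3 (arXiv:1512.06894 pp. 10–11)] -/
theorem controlUpperOnTreeAt_of_natCard_invariants_le {P : (W.baseChange K).toAffine.Point}
    (hfin : Finite (IwasawaDual.endInvariants (conjSelmerAc (W.baseChange K) p κ 𝔭 ∅ γ - 1)))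
    {m : ℕ}
    (hle : Nat.card (IwasawaDual.endInvariants (conjSelmerAc (W.baseChange K) p κ 𝔭 ∅ γ - 1)) ≤
      p ^ m)
    (hm : (m : ℤ) ≤ (padicValNat p
        (Nat.card (AddCommGroup.primaryComponent (W.baseChange K).sha p)) : ℤ) +
      2 * ((padicLogOrd W p ι P - 1) - (padicValNat p (AddSubgroup.zmultiples P).index : ℤ)) +
        padicValNat p (tamagawaProductSplit W K)) :
    ControlUpperOnTreeAt p κ 𝔭 γ ι P := by
  have hp : p.Prime := Fact.out
  obtain ⟨n, hn⟩ := exists_hasCharValuationAt_of_finite_invariants p κ 𝔭 γ hfin (W := W)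
  refine ⟨n, hn, le_trans ?_ hm⟩
  haveI := module_finite_XAc_baseChange p κ 𝔭 γ (W := W)
  obtain ⟨hfin', hcard⟩ := (XAc.hasCharValuationAt_iff_card _ p κ 𝔭 ∅ γ n).mp hn
  -- `Sel_γ` is a quotient of the `p`-primary `Sel`, non-empty: `#Sel_γ ≥ 1` once finite; if it is
  -- infinite its `Nat.card` is `0` and `#Sel^γ = 0`, impossible for a finite non-empty group.
  have hcoinv : 1 ≤ Nat.card (IwasawaDual.EndCoinvariants
      (conjSelmerAc (W.baseChange K) p κ 𝔭 ∅ γ - 1)) := by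
    rcases Nat.eq_zero_or_pos (Nat.card (IwasawaDual.EndCoinvariants
      (conjSelmerAc (W.baseChange K) p κ 𝔭 ∅ γ - 1))) with h0 | h0
    · exfalso
      rw [h0, mul_zero] at hcard
      haveI := hfin
      exact (Nat.card_pos (α := IwasawaDual.endInvariants
        (conjSelmerAc (W.baseChange K) p κ 𝔭 ∅ γ - 1))).ne' hcard
    · exact h0
  have hpow : p ^ n ≤ p ^ m := by
    calc p ^ n = p ^ n * 1 := (mul_one _).symm
      _ ≤ p ^ n * Nat.card (IwasawaDual.EndCoinvariants
          (conjSelmerAc (W.baseChange K) p κ 𝔭 ∅ γ - 1)) := Nat.mul_le_mul_left _ hcoinv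
      _ = Nat.card (IwasawaDual.endInvariants (conjSelmerAc (W.baseChange K) p κ 𝔭 ∅ γ - 1)) :=
          hcard.symm
      _ ≤ p ^ m := hle
  exact_mod_cast (Nat.pow_le_pow_iff_right hp.one_lt).mp hpow

/-! ### The datum chain with (CTL≤)ᵗ -/

/-- **The shadow-free lower bound from the one-sided links**: (IMC≥∘BDP)ᵗ and (CTL≤)ᵗ at the same
`(κ, γ, 𝔭, ι)` give `2·ord_p[E(K):ℤP] ≤ ord_p #Ш(E/K)[p^∞] + ord_p ∏_{w∣N⁺} c_w(E/K)` — both links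
are INEQUALITIES on `ord_p f_ac(0)`, which cancels. CONDITIONAL on the open link.
[cite: JetchevSkinnerWan2017, §7.4.1 (eq:shalowerK-1) (arXiv:1512.06894 p. 30)] -/
theorem two_mul_index_le_of_onTreeUpperLinks {P : (W.baseChange K).toAffine.Point}
    (hIW : IMCLowerWaldspurgerOnTreeAt p κ 𝔭 γ ι P) (hCTL : ControlUpperOnTreeAt p κ 𝔭 γ ι P) :
    2 * (padicValNat p (AddSubgroup.zmultiples P).index : ℤ) ≤
      (padicValNat p (Nat.card (AddCommGroup.primaryComponent (W.baseChange K).sha p)) : ℤ) +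
        padicValNat p (tamagawaProductSplit W K) := by
  obtain ⟨n, hn, hle⟩ := hIW
  obtain ⟨n', hn', hle'⟩ := hCTL
  obtain rfl : n = n' := hn.unique hn'
  omega

/-- **STEP L at a classical Heegner field from the one-sided links, `Ш(E/K)` finite**: for `p ≥ 5`,
`K` imaginary quadratic with the Heegner hypothesis for `N_E` (so `∏_{w∣N⁺} c_w = ∏_w c_w(E/K)`
and `ord_p ∏_w c_w(E/K) = 2·ord_p ∏_ℓ c_ℓ(E)` — theorems of the tree), (IMC≥∘BDP)ᵗ and (CTL≤)ᵗ give
`IndexLowerBoundAt W p K P`. CONDITIONAL on the open link.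
[cite: JetchevSkinnerWan2017, §7.4.1 (eq:shalowerK-1) and §7.3.1 (eq:tamK) (arXiv:1512.06894 p. 30)]
[cite: Castella2018, (1.1) (p. 2), Thm. 2.3 (p. 5), Thm. 3.2 (p. 9)] -/
theorem indexLowerBoundAt_of_onTreeUpperLinks_of_heegner (hp : 5 ≤ p) (hK : IsImaginaryQuadratic K)
    {N : ℕ} (hN : W.conductorNorm ℤ = N) (hH : SatisfiesHeegnerHypothesis N K)
    {P : (W.baseChange K).toAffine.Point} [Finite (W.baseChange K).sha]
    (hIW : IMCLowerWaldspurgerOnTreeAt p κ 𝔭 γ ι P) (hCTL : ControlUpperOnTreeAt p κ 𝔭 γ ι P) :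
    IndexLowerBoundAt W p K P := by
  haveI : Finite (AddCommGroup.primaryComponent (W.baseChange K).sha p) :=
    Finite.of_injective _ Subtype.val_injective
  have h := two_mul_index_le_of_onTreeUpperLinks hIW hCTL
  rw [padicValNat_tamagawaProductSplit_eq_of_heegner W p K hp hK hN hH,
    padicValNat_tamagawaProduct_baseChange_of_heegner W p hp K hK hN hH,
    padicValNat_card_addPrimaryComponent] at h
  unfold IndexLowerBoundAt
  rw [WeierstrassCurve.shaOrder]
  omega

end Links

/-! ### The datum of the route: finiteness and the degree-one prime discharged -/

section Datum

variable (W : WeierstrassCurve ℚ) [W.IsElliptic] [W.IsGloballyMinimal] (p : ℕ) [Fact p.Prime]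
  (N : ℕ) [NeZero N] (K : Type) [Field K] [NumberField K]
  (Dt : ModularParametrizationData W N) (H : HeegnerDatum N (NumberField.discr K)) (ι : K →+* ℂ)
  (P : (W.baseChange K).toAffine.Point)

/-- **STEP L at a classical Heegner datum from the one-sided links at one `(κ, γ, 𝔭, ι)`,
finiteness of `Ш(E/K)` discharged** (Gross–Zagier + Kolyvagin at the non-torsion Heegner point).
CONDITIONAL on the open link. [cite: JetchevSkinnerWan2017, §7.4.1 (eq:shalowerK-1) (arXiv:1512.06894 p. 30)]
[cite: Castella2018, Thm. 2.3 (p. 5), Thm. 3.2 (p. 9)] [cite: Kolyvagin1990, Thm. A] -/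
theorem indexLowerBoundAt_of_heegner_of_onTreeUpperLinks
    (hGZ : gross_zagier N W K) (hKo : kolyvagin N W K) (hmod : hasEntireLFunction_rat)
    (hp : 5 ≤ p) (hr : W.analyticRank = 1) (hN : W.conductorNorm ℤ = N) (hK : IsImaginaryQuadratic K)
    (hHN : SatisfiesHeegnerHypothesis N K)
    (hLt : (W.quadraticTwist (NumberField.discr K : ℚ)).entireLFunction 1 ≠ 0)
    (hP : WeierstrassCurve.Affine.Point.map ι.toRatAlgHom P = heegnerPointComplex Dt H)
    {κ : ZpExtension K p} {𝔭 : HeightOneSpectrum (𝓞 K)} {γ : Field.absoluteGaloisGroup K}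
    [Fact (κ.IsTopGenerator γ)] {ιp : K →+* ℚ_[p]}
    (hIW : IMCLowerWaldspurgerOnTreeAt p κ 𝔭 γ ιp P) (hCTL : ControlUpperOnTreeAt p κ 𝔭 γ ιp P) :
    IndexLowerBoundAt W p K P := by
  haveI : Finite (W.baseChange K).sha :=
    finite_sha_baseChange_of_heegner W N K Dt H ι P hGZ hKo hmod hr hK hHN hLt hP
  exact indexLowerBoundAt_of_onTreeUpperLinks_of_heegner hp hK hN hHN hIW hCTL

/-- **STEP L at a classical Heegner datum from the one-sided links in route R1's idiom** (for
every anticyclotomic `κ`, generator `γ`, degree-one `𝔭 ∋ p`, with THE embedding `embAt K p 𝔭`; such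
`(κ, γ, 𝔭)` exist by global reciprocity and `p ∣ N_E` splits in the Heegner field). CONDITIONAL on
the open link. [cite: JetchevSkinnerWan2017, §7.4.1 (eq:shalowerK-1) (arXiv:1512.06894 p. 30)]
[cite: Castella2018, Thm. 2.3 (p. 5), Thm. 3.2 (p. 9)] [cite: Castella2018Erratum, (2.4) (p. 1)] -/
theorem indexLowerBoundAt_of_heegner_of_onTreeUpperInputs
    (hGZ : gross_zagier N W K) (hKo : kolyvagin N W K) (hmod : hasEntireLFunction_rat)
    (hp : 5 ≤ p) (hr : W.analyticRank = 1) (hmult : Mult W p) (hN : W.conductorNorm ℤ = N)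
    (hK : IsImaginaryQuadratic K) (hHN : SatisfiesHeegnerHypothesis N K)
    (hLt : (W.quadraticTwist (NumberField.discr K : ℚ)).entireLFunction 1 ≠ 0)
    (hP : WeierstrassCurve.Affine.Point.map ι.toRatAlgHom P = heegnerPointComplex Dt H)
    (hC : ∀ (κ : ZpExtension K p), κ.IsAnticyclotomic →
      ∀ (γ : Field.absoluteGaloisGroup K) [Fact (κ.IsTopGenerator γ)] (𝔭 : HeightOneSpectrum (𝓞 K))
        (h𝔭 : ((p : ℕ) : 𝓞 K) ∈ 𝔭.asIdeal) (he : 𝔭.asIdeal.ramificationIdx (𝓞 ℚ) = 1)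
        (hf : 𝔭.asIdeal.inertiaDeg (𝓞 ℚ) = 1),
        ControlUpperOnTreeAt p κ 𝔭 γ (embAt K p 𝔭 h𝔭 he hf) P)
    (hA : ∀ (κ : ZpExtension K p), κ.IsAnticyclotomic →
      ∀ (γ : Field.absoluteGaloisGroup K) [Fact (κ.IsTopGenerator γ)] (𝔭 : HeightOneSpectrum (𝓞 K))
        (h𝔭 : ((p : ℕ) : 𝓞 K) ∈ 𝔭.asIdeal) (he : 𝔭.asIdeal.ramificationIdx (𝓞 ℚ) = 1)
        (hf : 𝔭.asIdeal.inertiaDeg (𝓞 ℚ) = 1),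
        IMCLowerWaldspurgerOnTreeAt p κ 𝔭 γ (embAt K p 𝔭 h𝔭 he hf) P) :
    IndexLowerBoundAt W p K P := by
  have hpN : p ∣ N := hN ▸ dvd_conductorNorm_of_mult hmult
  have hsplit : SplitsIn K p := hHN p Fact.out hpN
  obtain ⟨κ, γ, 𝔭, hκ, hγ, h𝔭⟩ := exists_anticyclotomic_generator_prime (p := p) hK
  haveI : Fact (κ.IsTopGenerator γ) := ⟨hγ⟩
  obtain ⟨he, hf⟩ := degreeOne_of_splitsIn hK.1 hsplit h𝔭
  exact indexLowerBoundAt_of_heegner_of_onTreeUpperLinks W p N K Dt H ι P hGZ hKo hmod hp hr hN hK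
    hHN hLt hP (hA κ hκ γ 𝔭 h𝔭 he hf) (hC κ hκ γ 𝔭 h𝔭 he hf)

end Datum

end Summit.BirchSwinnertonDyer.Rank1Residual.X11b

end
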